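import Mathlib
import Literature.NumberTheory.Sieve.EulerMascheroniEin

/-!
# Stub P3 `LiaSymbolBound` (line `child_tangent_analytic_strip(_L)`, cruxes 23320 / 28295) — KERNEL-ONLY numerics, brick 1:
# alternating Taylor enclosures of `e^{−y}` (all `y ≥ 0`) and of `Ein`, and an enclosure of `γ`

Hand leafhand-ns-filamentskeletonrs-7 g1 (prover), 2026-08-31, `--supports stmt-NavierStokesRegularity-23320 --as helper`.
Purpose: the registered stub `stub_liaSymbol : LiaSymbolBound` is discharged by `…TangentSkeletonNearStraightLiaSymbol.stub_liaSymbol`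
(p656939), whose window `numerics_window` (`Φ(p) ∈ [−1/12, p/3]` on `[1/50, 3]`) rests on ONE `native_decide` (`…NumericsCert.certificate`).
The owed kernel-only replacement (tenure P5-(B)) evaluates `E(p) = 2K₀(2√p)` and `C(p) = 2√p·K₁(2√p)` by SERIES at rational nodes; this file
supplies the elementary enclosures such a series evaluation consumes, all def-free and with standard axioms:
* §1 `expTaylor_alternating`: `0 ≤ (−1)^n (e^{−y} − Σ_{k<n} (−y)^k/k!)` for every `n` and every `y ≥ 0` (no `|y| ≤ 1` restriction, unlike
  `Real.exp_bound`), whence `|e^{−y} − Σ_{k<n} (−y)^k/k!| ≤ yⁿ/n!` and the even/odd one-sided bounds;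
* §2 `ein_alternating`: `0 ≤ (−1)^n (Ein x − Σ_{k<n} (−1)^k x^{k+1}/((k+1)(k+1)!))` for `x ≥ 0` (`Ein` = `Literature.NumberTheory.Sieve.ein`);
* §3 `eulerMascheroni_encl`: `γ = Ein a − log a − E₁(a)` with `0 ≤ E₁(a) ≤ e^{−a}/a` (`Literature…ein_eq_add`), and the numeric instance
  `eulerMascheroni_bounds : 0.57721 ≤ γ ≤ 0.57726` (`a = 8`, 36/37 terms; Mathlib only has `1/2 < γ < 2/3`).

HONEST FRAMING: elementary real analysis serving certified numerics for one explicit real integral of a HYPOTHETICAL filament-skeleton line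
on the NEGATIVE side of a MODEL route; nothing here bears on Navier–Stokes regularity or blow-up.
-/

set_option linter.dupNamespace false

noncomputable section

namespace Summit.NavierStokesRegularity.NavierStokesRegularity.Theorems.AnalyticStripLiaSymbol

namespace Series

open Real Set MeasureTheory Filter Topology Finset
open Literature.NumberTheory.Sieve

/-! ## §1  Alternating Taylor bounds for `e^{−y}`, `y ≥ 0` -/

/-- `d/dy Σ_{k<n+1} (−y)^k/k! = −Σ_{k<n} (−y)^k/k!`. -/
theorem hasDerivAt_expTaylor (n : ℕ) (y : ℝ) :
    HasDerivAt (fun y : ℝ => ∑ k ∈ range (n + 1), (-y) ^ k / (k.factorial : ℝ))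
      (-(∑ k ∈ range n, (-y) ^ k / (k.factorial : ℝ))) y := by
  induction n with
  | zero =>
    simp only [zero_add, range_one, sum_singleton, pow_zero, Nat.factorial_zero, Nat.cast_one, div_one,
      range_zero, sum_empty, neg_zero]
    exact hasDerivAt_const y 1
  | succ n ih =>
    have h : (fun y : ℝ => ∑ k ∈ range (n + 1 + 1), (-y) ^ k / (k.factorial : ℝ))
        = fun y => (∑ k ∈ range (n + 1), (-y) ^ k / (k.factorial : ℝ)) + (-y) ^ (n + 1) / ((n + 1).factorial : ℝ) := by
      funext y; rw [sum_range_succ]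
    rw [h]
    have hlast : HasDerivAt (fun y : ℝ => (-y) ^ (n + 1) / ((n + 1).factorial : ℝ))
        (-((-y) ^ n / (n.factorial : ℝ))) y := by
      have h1 : HasDerivAt (fun y : ℝ => (-y) ^ (n + 1)) (((n : ℝ) + 1) * (-y) ^ n * (-1)) y := by
        have := (hasDerivAt_neg y).fun_pow (n + 1)
        simpa using this
      refine (h1.div_const ((n + 1).factorial : ℝ)).congr_deriv ?_
      rw [Nat.factorial_succ]
      push_cast
      have hn : ((n.factorial : ℕ) : ℝ) ≠ 0 := by exact_mod_cast (Nat.factorial_pos n).ne'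
      field_simp
    exact (ih.fun_add hlast).congr_deriv (by rw [sum_range_succ]; ring)

/-- **Alternating Taylor bound for `e^{−y}`**: `0 ≤ (−1)^n·(e^{−y} − Σ_{k<n} (−y)^k/k!)` for all `n` and all `y ≥ 0`
(Lagrange remainder sign; proved by induction via monotonicity). -/
theorem expTaylor_alternating (n : ℕ) : ∀ y : ℝ, 0 ≤ y →
    0 ≤ (-1 : ℝ) ^ n * (Real.exp (-y) - ∑ k ∈ range n, (-y) ^ k / (k.factorial : ℝ)) := by
  induction n with
  | zero => intro y _; simp [Real.exp_nonneg]
  | succ n ih =>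
    intro y hy
    set f : ℝ → ℝ := fun y => (-1 : ℝ) ^ (n + 1) *
      (Real.exp (-y) - ∑ k ∈ range (n + 1), (-y) ^ k / (k.factorial : ℝ)) with hfdef
    have hf' : ∀ z : ℝ, HasDerivAt f
        ((-1 : ℝ) ^ n * (Real.exp (-z) - ∑ k ∈ range n, (-z) ^ k / (k.factorial : ℝ))) z := by
      intro z
      have he : HasDerivAt (fun y : ℝ => Real.exp (-y)) (-Real.exp (-z)) z := by
        simpa using (hasDerivAt_neg z).exp
      refine ((he.fun_sub (hasDerivAt_expTaylor n z)).const_mul ((-1 : ℝ) ^ (n + 1))).congr_deriv ?_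
      rw [pow_succ]
      ring
    have hf0 : f 0 = 0 := by
      simp only [hfdef, neg_zero, Real.exp_zero]
      rw [sum_range_succ']
      simp
    have hcont : ContinuousOn f (Ici 0) := fun z _ => (hf' z).continuousAt.continuousWithinAt
    have hdiff : DifferentiableOn ℝ f (interior (Ici (0:ℝ))) := fun z _ => (hf' z).differentiableAt.differentiableWithinAt
    have hnn : ∀ z ∈ interior (Ici (0:ℝ)), 0 ≤ deriv f z := by
      intro z hz
      rw [interior_Ici] at hz
      rw [(hf' z).deriv]
      exact ih z (le_of_lt hz)
    have hmono := monotoneOn_of_deriv_nonneg (convex_Ici 0) hcont hdiff hnn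
    have := hmono (self_mem_Ici (a := (0:ℝ))) (mem_Ici.mpr hy) hy
    rw [hf0] at this
    exact this

/-- Two-sided form: `|e^{−y} − Σ_{k<n} (−y)^k/k!| ≤ yⁿ/n!` for `y ≥ 0` (any `n`, any `y ≥ 0`). -/
theorem abs_exp_neg_sub_taylor_le (n : ℕ) {y : ℝ} (hy : 0 ≤ y) :
    |Real.exp (-y) - ∑ k ∈ range n, (-y) ^ k / (k.factorial : ℝ)| ≤ y ^ n / (n.factorial : ℝ) := by
  have h1 := expTaylor_alternating n y hy
  have h2 := expTaylor_alternating (n + 1) y hy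
  rw [sum_range_succ, pow_succ, neg_pow y n] at h2
  have hpos : 0 ≤ y ^ n / (n.factorial : ℝ) := by positivity
  set c := y ^ n / (n.factorial : ℝ) with hc
  have h2' : 0 ≤ (-1 : ℝ) ^ n * -1 *
      (Real.exp (-y) - (∑ k ∈ range n, (-y) ^ k / (k.factorial : ℝ) + (-1 : ℝ) ^ n * c)) := by
    have : (-1 : ℝ) ^ n * y ^ n / (n.factorial : ℝ) = (-1 : ℝ) ^ n * c := by rw [hc]; ring
    rw [← this]; exact h2
  rw [abs_le]
  rcases neg_one_pow_eq_or ℝ n with h | h <;> rw [h] at h1 h2' <;> norm_num at h1 h2' <;> constructor <;> linarith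

/-- Even partial sums are BELOW `e^{−y}` (`y ≥ 0`). -/
theorem taylor_even_le_exp_neg (m : ℕ) {y : ℝ} (hy : 0 ≤ y) :
    ∑ k ∈ range (2 * m), (-y) ^ k / (k.factorial : ℝ) ≤ Real.exp (-y) := by
  have h := expTaylor_alternating (2 * m) y hy
  have h1 : ((-1 : ℝ) ^ 2) ^ m = 1 := by norm_num
  rw [pow_mul, h1, one_mul] at h; linarith

/-- Odd partial sums are ABOVE `e^{−y}` (`y ≥ 0`). -/
theorem exp_neg_le_taylor_odd (m : ℕ) {y : ℝ} (hy : 0 ≤ y) :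
    Real.exp (-y) ≤ ∑ k ∈ range (2 * m + 1), (-y) ^ k / (k.factorial : ℝ) := by
  have h := expTaylor_alternating (2 * m + 1) y hy
  have h1 : ((-1 : ℝ) ^ 2) ^ m = 1 := by norm_num
  rw [pow_succ, pow_mul, h1, one_mul] at h; linarith

/-! ## §2  Alternating polynomial bounds for `Ein x = ∫₀ˣ (1 − e^{−t})/t dt`, `x ≥ 0` -/

/-- `d/dx Σ_{k<n} (−1)^k x^{k+1}/((k+1)(k+1)!) = Σ_{k<n} (−1)^k x^k/(k+1)!`. -/
theorem hasDerivAt_einTaylor (n : ℕ) (x : ℝ) :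
    HasDerivAt (fun x : ℝ => ∑ k ∈ range n, (-1 : ℝ) ^ k * x ^ (k + 1) / (((k + 1 : ℕ) : ℝ) * ((k + 1).factorial : ℝ)))
      (∑ k ∈ range n, (-1 : ℝ) ^ k * x ^ k / ((k + 1).factorial : ℝ)) x := by
  have hterm : ∀ k ∈ range n, HasDerivAt
      (fun x : ℝ => (-1 : ℝ) ^ k * x ^ (k + 1) / (((k + 1 : ℕ) : ℝ) * ((k + 1).factorial : ℝ)))
      ((-1 : ℝ) ^ k * x ^ k / ((k + 1).factorial : ℝ)) x := by
    intro k _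
    have h := ((hasDerivAt_pow (k + 1) x).const_mul ((-1 : ℝ) ^ k)).div_const
      (((k + 1 : ℕ) : ℝ) * ((k + 1).factorial : ℝ))
    refine h.congr_deriv ?_
    rw [Nat.add_sub_cancel]
    have hk : ((k + 1 : ℕ) : ℝ) ≠ 0 := by positivity
    have hf : (((k + 1).factorial : ℕ) : ℝ) ≠ 0 := by positivity
    field_simp
  exact HasDerivAt.fun_sum hterm

/-- For `t > 0`: `(−1)^n·(einKernel t − Σ_{k<n} (−1)^k t^k/(k+1)!) ≥ 0`, where `einKernel t = (1 − e^{−t})/t`. -/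
theorem einKernel_alternating (n : ℕ) {t : ℝ} (ht : 0 < t) :
    0 ≤ (-1 : ℝ) ^ n * (einKernel t - ∑ k ∈ range n, (-1 : ℝ) ^ k * t ^ k / ((k + 1).factorial : ℝ)) := by
  have h := expTaylor_alternating (n + 1) t ht.le
  rw [einKernel_eq_div ht.ne']
  -- `Σ_{k<n+1} (−t)^k/k! = Σ_{k<n} (−t)^{k+1}/(k+1)! + 1`
  rw [sum_range_succ'] at h
  simp only [pow_zero, Nat.factorial_zero, Nat.cast_one, div_one] at h
  have hsum : ∑ k ∈ range n, (-1 : ℝ) ^ k * t ^ k / ((k + 1).factorial : ℝ)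
      = -(∑ k ∈ range n, (-t) ^ (k + 1) / ((k + 1).factorial : ℝ)) / t := by
    rw [eq_div_iff ht.ne', ← sum_neg_distrib, sum_mul]
    refine sum_congr rfl (fun k _ => ?_)
    rw [neg_pow t (k + 1), pow_succ (-1 : ℝ) k, pow_succ t k]
    have hf : (((k + 1).factorial : ℕ) : ℝ) ≠ 0 := by positivity
    field_simp
  rw [hsum]
  have key : (1 - Real.exp (-t)) / t - -(∑ k ∈ range n, (-t) ^ (k + 1) / ((k + 1).factorial : ℝ)) / t
      = ((-1 : ℝ) * (Real.exp (-t) - (∑ k ∈ range n, (-t) ^ (k + 1) / ((k + 1).factorial : ℝ) + 1))) / t := by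
    field_simp
    ring
  rw [key, ← mul_div_assoc, ← mul_assoc]
  rw [pow_succ] at h
  exact div_nonneg h ht.le

/-- **Alternating bound for `Ein`**: `0 ≤ (−1)^n·(Ein x − Σ_{k<n} (−1)^k x^{k+1}/((k+1)(k+1)!))` for `x ≥ 0`. -/
theorem ein_alternating (n : ℕ) {x : ℝ} (hx : 0 ≤ x) :
    0 ≤ (-1 : ℝ) ^ n * (ein x - ∑ k ∈ range n, (-1 : ℝ) ^ k * x ^ (k + 1) / (((k + 1 : ℕ) : ℝ) * ((k + 1).factorial : ℝ))) := by
  set f : ℝ → ℝ := fun x => (-1 : ℝ) ^ n *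
    (ein x - ∑ k ∈ range n, (-1 : ℝ) ^ k * x ^ (k + 1) / (((k + 1 : ℕ) : ℝ) * ((k + 1).factorial : ℝ))) with hfdef
  have hf' : ∀ z : ℝ, HasDerivAt f
      ((-1 : ℝ) ^ n * (einKernel z - ∑ k ∈ range n, (-1 : ℝ) ^ k * z ^ k / ((k + 1).factorial : ℝ))) z :=
    fun z => ((hasDerivAt_ein z).sub (hasDerivAt_einTaylor n z)).const_mul _
  have hf0 : f 0 = 0 := by simp [hfdef, ein_zero]
  have hcont : ContinuousOn f (Ici 0) := fun z _ => (hf' z).continuousAt.continuousWithinAt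
  have hdiff : DifferentiableOn ℝ f (interior (Ici (0:ℝ))) := fun z _ => (hf' z).differentiableAt.differentiableWithinAt
  have hnn : ∀ z ∈ interior (Ici (0:ℝ)), 0 ≤ deriv f z := by
    intro z hz
    rw [interior_Ici] at hz
    rw [(hf' z).deriv]
    exact einKernel_alternating n hz
  have hmono := monotoneOn_of_deriv_nonneg (convex_Ici 0) hcont hdiff hnn
  have := hmono (self_mem_Ici (a := (0:ℝ))) (mem_Ici.mpr hx) hx
  rw [hf0] at this
  exact this

/-- Even partial sums are BELOW `Ein x` (`x ≥ 0`). -/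
theorem einTaylor_even_le (m : ℕ) {x : ℝ} (hx : 0 ≤ x) :
    ∑ k ∈ range (2 * m), (-1 : ℝ) ^ k * x ^ (k + 1) / (((k + 1 : ℕ) : ℝ) * ((k + 1).factorial : ℝ)) ≤ ein x := by
  have h := ein_alternating (2 * m) hx
  have h1 : ((-1 : ℝ) ^ 2) ^ m = 1 := by norm_num
  rw [pow_mul, h1, one_mul] at h; linarith

/-- Odd partial sums are ABOVE `Ein x` (`x ≥ 0`). -/
theorem ein_le_einTaylor_odd (m : ℕ) {x : ℝ} (hx : 0 ≤ x) :
    ein x ≤ ∑ k ∈ range (2 * m + 1), (-1 : ℝ) ^ k * x ^ (k + 1) / (((k + 1 : ℕ) : ℝ) * ((k + 1).factorial : ℝ)) := by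
  have h := ein_alternating (2 * m + 1) hx
  have h1 : ((-1 : ℝ) ^ 2) ^ m = 1 := by norm_num
  rw [pow_succ, pow_mul, h1, one_mul] at h; linarith

/-! ## §3  The exponential integral at large argument and an enclosure of `γ` -/

/-- `0 ≤ E₁(a)` for `a > 0`. -/
theorem expIntegralE1_nonneg {a : ℝ} (ha : 0 < a) : 0 ≤ expIntegralE1 a :=
  setIntegral_nonneg measurableSet_Ioi fun t (ht : a < t) => div_nonneg (Real.exp_pos _).le (ha.trans ht).le

/-- `E₁(a) ≤ e^{−a}/a` for `a > 0`. -/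
theorem expIntegralE1_le {a : ℝ} (ha : 0 < a) : expIntegralE1 a ≤ Real.exp (-a) / a := by
  rw [expIntegralE1]
  have hI : IntegrableOn (fun t : ℝ => Real.exp (-t) / a) (Ioi a) :=
    (integrableOn_exp_neg_Ioi a).div_const a
  calc ∫ t in Ioi a, Real.exp (-t) / t ≤ ∫ t in Ioi a, Real.exp (-t) / a := by
        refine setIntegral_mono_on (integrableOn_exp_neg_div_Ioi ha) hI measurableSet_Ioi (fun t ht => ?_)
        exact div_le_div_of_nonneg_left (Real.exp_pos _).le ha (le_of_lt ht)
    _ = Real.exp (-a) / a := by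
        rw [integral_div, integral_exp_neg_Ioi]

/-- **`γ` through `Ein` at any `a > 0`**: `Ein a − log a − e^{−a}/a ≤ γ ≤ Ein a − log a`. -/
theorem eulerMascheroni_encl {a : ℝ} (ha : 0 < a) :
    ein a - Real.log a - Real.exp (-a) / a ≤ Real.eulerMascheroniConstant ∧
      Real.eulerMascheroniConstant ≤ ein a - Real.log a := by
  have h := ein_eq_add ha
  have h0 := expIntegralE1_nonneg ha
  have h1 := expIntegralE1_le ha
  constructor <;> linarith

/-- **Numeric enclosure of the Euler–Mascheroni constant**: `0.57721 ≤ γ ≤ 0.57726` (`a = 8`: `Ein 8` by 36/37 alternating terms,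
`log 8 = 3 log 2` by Mathlib's `log 2` decimals, `0 ≤ E₁(8) ≤ e^{−8}/8 ≤ Σ_{k<41}(−8)^k/k!/8`). -/
theorem eulerMascheroni_bounds :
    (0.57721 : ℝ) ≤ Real.eulerMascheroniConstant ∧ Real.eulerMascheroniConstant ≤ 0.57726 := by
  have h8 : (0:ℝ) < 8 := by norm_num
  obtain ⟨hlo, hhi⟩ := eulerMascheroni_encl h8
  have hEinLo := einTaylor_even_le 18 h8.le
  have hEinHi := ein_le_einTaylor_odd 18 h8.le
  have hExp := exp_neg_le_taylor_odd 20 h8.le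
  have hlog : Real.log 8 = 3 * Real.log 2 := by
    rw [show (8:ℝ) = 2 ^ 3 by norm_num, Real.log_pow]; norm_num
  have hl2 := Real.log_two_gt_d9
  have hl2' := Real.log_two_lt_d9
  norm_num [sum_range_succ, Nat.factorial] at hEinLo hEinHi hExp
  rw [hlog] at hlo hhi
  constructor
  · have : Real.exp (-8) / 8 ≤ _ / 8 := div_le_div_of_nonneg_right hExp (by norm_num)
    linarith
  · linarith

end Series

end Summit.NavierStokesRegularity.NavierStokesRegularity.Theorems.AnalyticStripLiaSymbol

end
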